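import Literature.Analysis.ODE.LinearPeriodicAveragingForced
import HarnessLib

/-!
# First-order averaging for a forced linear dissipative system — the forcing measured in the WEIGHTED `L¹` norm
# `∫₀ᵗ e^{-r_lo (t-s)} ‖ρ(s)‖ ds` (Sanders–Verhulst–Murdock Thm 2.8.1 / Lemma 2.8.2 / Thm 5.5.1, inhomogeneous linear case; Hale Ch. V §3)

Topic `Literature/Analysis/ODE` (namespace `Literature.Analysis.ODE.PeriodicAveraging`).  Everything here is PROVED (no named fact, no definition, no
instance, no `sorry`).  Refines `LinearPeriodicAveragingForced.norm_sub_exp_apply_le_forced` (there the forcing enters through `sup ‖ρ‖`): for a forcing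
with a large but fast-decaying initial layer (the situation of a slaved fast variable started away from its slaved state) the supremum bound is useless
while the weighted `L¹` bound is sharp.

THE ESTIMATE (`norm_sub_exp_apply_le_forced_weighted`).  `Ḡ` coercive (`r_lo ‖v‖² ≤ ⟪Ḡ v, v⟫`, `‖Ḡ‖ ≤ Gn`), `g` continuous with `‖g(s)‖ ≤ L` and window
means `‖∫_{nP}^{(n+1)P} g‖ ≤ η P`, `ρ` continuous on `[0,t]`, `x` continuous on `[0,t]` solving `x' = -(Ḡ + g(s))x + ρ(s)` on `(0,t)` with `‖x(s)‖ ≤ M`: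
`‖x(t) - exp(-tḠ) x(0)‖ ≤ M·(η (min(t,1/r_lo) + P) + L P (1 + (2 Gn + L)/r_lo)) + (1 + L P)·∫₀ᵗ e^{-r_lo(t-s)} ‖ρ(s)‖ ds`.

THE PROOF is that of the forced file with the forcing kept under the integral: in Besjes' window identity (`integral_window_eq_forced`) the extra bulk
term `∫ₐᵇ exp(-(t-s)Ḡ) G_a(s) ρ(s) ds` is bounded by `L P ∫ₐᵇ e^{-r_lo(t-s)} ‖ρ(s)‖ ds` (`norm_integral_window_le_forced_weighted`), these contributions ADD
UP over the windows to `L P ∫₀ᵗ e^{-r_lo(t-s)}‖ρ‖`, and the Duhamel forcing integral is `≤ ∫₀ᵗ e^{-r_lo(t-s)}‖ρ‖` by the contraction of `exp(-τḠ)`.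

## Mathlib / tree search
Tree: `LinearPeriodicAveragingForced` (`sub_exp_apply_eq_forced`, `integral_window_eq_forced`, reused verbatim), `LinearPeriodicAveraging.norm_exp_neg_smul_apply_le`.
Mathlib: `intervalIntegral.norm_integral_le_of_norm_le` (non-constant majorant), `sum_integral_adjacent_intervals`.

## References
* J. A. Sanders, F. Verhulst, J. Murdock, *Averaging Methods in Nonlinear Dynamical Systems*, 2nd ed., Springer (2007): Theorem 2.8.1, Lemma 2.8.2
  (Besjes), Theorem 5.5.1 (held: `book:sandersnd-averaging-methods-nonlinear-dynamical-systems`, PDF pp. 68–69, 127–128). [`SandersVerhulstMurdock2007`]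
* J. K. Hale, *Ordinary Differential Equations*, 2nd ed., Krieger (1980), Ch. V §3 Lemma 3.2; Ch. III §1 eq. (1.9). [`Hale1980`]
-/

noncomputable section

open NormedSpace Set MeasureTheory intervalIntegral
open scoped InnerProductSpace

namespace Literature.Analysis.ODE.PeriodicAveraging

variable {E : Type*} [NormedAddCommGroup E] [InnerProductSpace ℝ E] [CompleteSpace E]

/-- Continuity of `s ↦ exp(-(t-s)Ḡ)` (file-local copy). [folklore] -/
private theorem continuous_exp_neg_sub_smul'' (G : E →L[ℝ] E) (t : ℝ) :
    Continuous fun s : ℝ => exp (-((t - s) • G)) := by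
  have h : ∀ s, HasDerivAt (fun u : ℝ => exp (-((t - u) • G))) (exp (-((t - s) • G)) * G) s := by
    intro s
    have h0 : HasDerivAt (fun u : ℝ => exp (-(u • G))) (-(exp (-((t - s) • G)) * G)) (t - s) := by
      have h := hasDerivAt_exp_smul_const (-G) (t - s)
      simp only [smul_neg, mul_neg] at h
      exact h
    have h := h0.scomp s ((hasDerivAt_id s).const_sub t)
    simpa [Function.comp_def] using h
  exact continuous_iff_continuousAt.2 fun s => (h s).continuousAt

/-- Continuity of the weight `s ↦ e^{-r_lo (t - s)}`. [folklore] -/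
private theorem continuous_weight (rlo t : ℝ) : Continuous fun s : ℝ => Real.exp (-(rlo * (t - s))) :=
  (continuous_const.mul (continuous_const.sub continuous_id)).neg.rexp

/-! ## §1 One window, the forcing kept under the integral -/

/-- **One window, bound, weighted forcing.**  With the contraction rate `r_lo` of `Ḡ`, `‖Ḡ‖ ≤ Gn`, `‖g‖ ≤ L`, `‖x‖ ≤ M` on `[0, t]`, `ρ` continuous on
`[0,t]`, a window `[a, b] ⊆ [0, t]` of length `b - a ≤ P` and `‖∫ₐᵇ g‖ ≤ μ`:
`‖∫ₐᵇ exp(-(t-s)Ḡ) g x‖ ≤ e^{-r_lo (t-b)} μ M + L P (2 Gn + L) M ∫ₐᵇ e^{-r_lo (t-s)} ds + L P ∫ₐᵇ e^{-r_lo(t-s)} ‖ρ s‖ ds`.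
[cite: SandersVerhulstMurdock2007, Lemma 2.8.2 (Besjes) and proof of Theorem 5.5.1] -/
theorem norm_integral_window_le_forced_weighted (G : E →L[ℝ] E) {g : ℝ → E →L[ℝ] E} (hg : Continuous g) {ρ : ℝ → E}
    (x : ℝ → E) {rlo Gn L M P μ a b t : ℝ} (ha : 0 ≤ a) (hab : a ≤ b) (hbt : b ≤ t)
    (hbaP : b - a ≤ P)
    (hcoer : ∀ v : E, rlo * ‖v‖ ^ 2 ≤ ⟪G v, v⟫_ℝ) (hGn : ‖G‖ ≤ Gn)
    (hL : ∀ s ∈ Icc 0 t, ‖g s‖ ≤ L) (hμ : ‖∫ σ in a..b, g σ‖ ≤ μ)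
    (hxc : ContinuousOn x (Icc 0 t)) (hρc : ContinuousOn ρ (Icc 0 t))
    (hx : ∀ s ∈ Ioo 0 t, HasDerivAt x (-(G (x s) + g s (x s)) + ρ s) s)
    (hM : ∀ s ∈ Icc 0 t, ‖x s‖ ≤ M) :
    ‖∫ s in a..b, exp (-((t - s) • G)) (g s (x s))‖ ≤
      Real.exp (-(rlo * (t - b))) * μ * M +
        L * P * (2 * Gn + L) * M * (∫ s in a..b, Real.exp (-(rlo * (t - s)))) +
        L * P * ∫ s in a..b, Real.exp (-(rlo * (t - s))) * ‖ρ s‖ := by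
  have hbI : b ∈ Icc 0 t := ⟨ha.trans hab, hbt⟩
  have hsubI : Icc a b ⊆ Icc 0 t := Icc_subset_Icc ha hbt
  have hM0 : 0 ≤ M := (norm_nonneg _).trans (hM b hbI)
  have hL0 : 0 ≤ L := (norm_nonneg _).trans (hL b hbI)
  have hGn0 : 0 ≤ Gn := (norm_nonneg _).trans hGn
  have hP0 : 0 ≤ P := (sub_nonneg.2 hab).trans hbaP
  rw [integral_window_eq_forced G hg x ha hab hbt hxc hρc hx]
  -- antiderivative bound ‖∫ₐˢ g‖ ≤ L P on [a, b]
  have hGa : ∀ s ∈ Icc a b, ‖∫ σ in a..s, g σ‖ ≤ L * P := by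
    intro s hs
    have h1 : ‖∫ σ in a..s, g σ‖ ≤ L * |s - a| := by
      refine norm_integral_le_of_norm_le_const fun σ hσ => hL σ ?_
      rw [uIoc_of_le hs.1] at hσ
      exact ⟨ha.trans hσ.1.le, (hσ.2.trans hs.2).trans hbt⟩
    rw [abs_of_nonneg (sub_nonneg.2 hs.1)] at h1
    exact h1.trans (mul_le_mul_of_nonneg_left ((sub_le_sub_right hs.2 a).trans hbaP) hL0)
  -- boundary term
  have hbd : ‖exp (-((t - b) • G)) ((∫ σ in a..b, g σ) (x b))‖ ≤ Real.exp (-(rlo * (t - b))) * μ * M := by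
    refine (norm_exp_neg_smul_apply_le G hcoer _ (sub_nonneg.2 hbt)).trans ?_
    rw [mul_assoc]
    refine mul_le_mul_of_nonneg_left ?_ (Real.exp_pos _).le
    exact (ContinuousLinearMap.le_opNorm _ _).trans (mul_le_mul hμ (hM b hbI) (norm_nonneg _)
      ((norm_nonneg _).trans hμ))
  -- the majorant of the bulk integrand and its integrability
  have hwc := continuous_weight rlo t
  have hmajc : ContinuousOn (fun s => L * P * (2 * Gn + L) * M * Real.exp (-(rlo * (t - s))) +
      L * P * (Real.exp (-(rlo * (t - s))) * ‖ρ s‖)) (Icc a b) :=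
    (continuous_const.mul hwc).continuousOn.add (continuousOn_const.mul (hwc.continuousOn.mul (hρc.mono hsubI).norm))
  have hbulk : ‖∫ s in a..b, exp (-((t - s) • G))
      (G ((∫ σ in a..s, g σ) (x s)) - (∫ σ in a..s, g σ) (G (x s) + g s (x s)) + (∫ σ in a..s, g σ) (ρ s))‖ ≤
      ∫ s in a..b, (L * P * (2 * Gn + L) * M * Real.exp (-(rlo * (t - s))) + L * P * (Real.exp (-(rlo * (t - s))) * ‖ρ s‖)) := by
    refine norm_integral_le_of_norm_le hab (Filter.Eventually.of_forall fun s hs => ?_) (hmajc.intervalIntegrable_of_Icc hab)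
    have hs' : s ∈ Icc a b := ⟨hs.1.le, hs.2⟩
    have hsI : s ∈ Icc 0 t := ⟨ha.trans hs.1.le, hs.2.trans hbt⟩
    refine (norm_exp_neg_smul_apply_le G hcoer _ (sub_nonneg.2 hsI.2)).trans ?_
    have hGas := hGa s hs'
    have hxs := hM s hsI
    have hgs := hL s hsI
    have h1 : ‖G ((∫ σ in a..s, g σ) (x s))‖ ≤ Gn * (L * P * M) :=
      (G.le_opNorm _).trans (mul_le_mul hGn (((∫ σ in a..s, g σ).le_opNorm _).trans
        (mul_le_mul hGas hxs (norm_nonneg _) (mul_nonneg hL0 hP0))) (norm_nonneg _) hGn0)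
    have h2 : ‖(∫ σ in a..s, g σ) (G (x s) + g s (x s))‖ ≤ L * P * ((Gn + L) * M) := by
      refine ((∫ σ in a..s, g σ).le_opNorm _).trans (mul_le_mul hGas ?_ (norm_nonneg _)
        (mul_nonneg hL0 hP0))
      refine (norm_add_le _ _).trans ?_
      rw [add_mul]
      exact add_le_add ((G.le_opNorm _).trans (mul_le_mul hGn hxs (norm_nonneg _) hGn0))
        (((g s).le_opNorm _).trans (mul_le_mul hgs hxs (norm_nonneg _) hL0))
    have h2' : ‖(∫ σ in a..s, g σ) (ρ s)‖ ≤ L * P * ‖ρ s‖ :=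
      ((∫ σ in a..s, g σ).le_opNorm _).trans (mul_le_mul_of_nonneg_right hGas (norm_nonneg _))
    have h3 : ‖G ((∫ σ in a..s, g σ) (x s)) - (∫ σ in a..s, g σ) (G (x s) + g s (x s)) + (∫ σ in a..s, g σ) (ρ s)‖ ≤
        L * P * (2 * Gn + L) * M + L * P * ‖ρ s‖ := by
      refine (norm_add_le _ _).trans ((add_le_add (norm_sub_le _ _) le_rfl).trans ?_)
      nlinarith [h1, h2, h2']
    calc Real.exp (-(rlo * (t - s))) *
          ‖G ((∫ σ in a..s, g σ) (x s)) - (∫ σ in a..s, g σ) (G (x s) + g s (x s)) + (∫ σ in a..s, g σ) (ρ s)‖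
        ≤ Real.exp (-(rlo * (t - s))) * (L * P * (2 * Gn + L) * M + L * P * ‖ρ s‖) :=
          mul_le_mul_of_nonneg_left h3 (Real.exp_pos _).le
      _ = L * P * (2 * Gn + L) * M * Real.exp (-(rlo * (t - s))) + L * P * (Real.exp (-(rlo * (t - s))) * ‖ρ s‖) := by ring
  have hi1 : IntervalIntegrable (fun s => L * P * (2 * Gn + L) * M * Real.exp (-(rlo * (t - s)))) volume a b :=
    (continuous_const.mul hwc).intervalIntegrable _ _
  have hi2 : IntervalIntegrable (fun s => L * P * (Real.exp (-(rlo * (t - s))) * ‖ρ s‖)) volume a b :=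
    (continuousOn_const.mul (hwc.continuousOn.mul (hρc.mono hsubI).norm)).intervalIntegrable_of_Icc hab
  have hsplit : ∫ s in a..b, (L * P * (2 * Gn + L) * M * Real.exp (-(rlo * (t - s))) + L * P * (Real.exp (-(rlo * (t - s))) * ‖ρ s‖)) =
      L * P * (2 * Gn + L) * M * (∫ s in a..b, Real.exp (-(rlo * (t - s)))) +
        L * P * ∫ s in a..b, Real.exp (-(rlo * (t - s))) * ‖ρ s‖ := by
    rw [intervalIntegral.integral_add hi1 hi2, intervalIntegral.integral_const_mul, intervalIntegral.integral_const_mul]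
  rw [hsplit] at hbulk
  calc _ ≤ ‖exp (-((t - b) • G)) ((∫ σ in a..b, g σ) (x b))‖ + ‖∫ s in a..b, exp (-((t - s) • G))
        (G ((∫ σ in a..s, g σ) (x s)) - (∫ σ in a..s, g σ) (G (x s) + g s (x s)) + (∫ σ in a..s, g σ) (ρ s))‖ := norm_sub_le _ _
    _ ≤ _ := by linarith [hbd, hbulk]

/-! ## §2 Summation over the windows -/

/-- Geometric sum of the contraction factors at the window ends (file-local copy): for `N P ≤ t`, `Σ_{k<N} e^{-r_lo (t - (k+1)P)} ≤ 1 + 1/(r_lo P)`.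
[folklore] -/
private theorem sum_exp_neg_le'' {rlo P t : ℝ} (hrlo : 0 < rlo) (hP : 0 < P) (N : ℕ) (hN : (N : ℝ) * P ≤ t) :
    ∑ k ∈ Finset.range N, Real.exp (-(rlo * (t - ((k : ℝ) + 1) * P))) ≤ 1 + 1 / (rlo * P) := by
  set q : ℝ := Real.exp (-(rlo * P)) with hq
  have hq0 : 0 ≤ q := (Real.exp_pos _).le
  have hq1 : q < 1 := Real.exp_lt_one_iff.2 (by nlinarith)
  have hterm : ∀ k ∈ Finset.range N,
      Real.exp (-(rlo * (t - ((k : ℝ) + 1) * P))) ≤ q ^ (N - 1 - k) := by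
    intro k hk
    rw [Finset.mem_range] at hk
    rw [hq, ← Real.exp_nat_mul, Real.exp_le_exp]
    have hcast : ((N - 1 - k : ℕ) : ℝ) = (N : ℝ) - 1 - k := by
      rw [Nat.cast_sub (by omega), Nat.cast_sub (by omega)]; simp
    rw [hcast]
    nlinarith
  calc ∑ k ∈ Finset.range N, Real.exp (-(rlo * (t - ((k : ℝ) + 1) * P)))
      ≤ ∑ k ∈ Finset.range N, q ^ (N - 1 - k) := Finset.sum_le_sum hterm
    _ = ∑ k ∈ Finset.range N, q ^ k := Finset.sum_range_reflect (fun k => q ^ k) N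
    _ ≤ ∑' k, q ^ k := (summable_geometric_of_lt_one hq0 hq1).sum_le_tsum _ (fun k _ => pow_nonneg hq0 k)
    _ = (1 - q)⁻¹ := tsum_geometric_of_lt_one hq0 hq1
    _ ≤ (1 - 1 / (1 + rlo * P))⁻¹ := by
        have hq' : q ≤ 1 / (1 + rlo * P) := by
          rw [hq, Real.exp_neg, ← one_div]
          exact one_div_le_one_div_of_le (by positivity) (by linarith [Real.add_one_le_exp (rlo * P)])
        have hpos : 0 < 1 - 1 / (1 + rlo * P) := by
          rw [sub_pos, div_lt_one (by positivity)]; nlinarith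
        exact inv_anti₀ hpos (sub_le_sub_left hq' 1)
    _ = 1 + 1 / (rlo * P) := by field_simp; ring

/-- `∫₀ᵗ e^{-r_lo (t - s)} ds ≤ 1/r_lo` (`r_lo > 0`, `t ≥ 0`). [folklore] -/
private theorem integral_exp_neg_sub_le_inv {rlo t : ℝ} (hrlo : 0 < rlo) :
    ∫ s in (0:ℝ)..t, Real.exp (-(rlo * (t - s))) ≤ 1 / rlo := by
  have hd : ∀ s, HasDerivAt (fun u => Real.exp (-(rlo * (t - u))) / rlo) (Real.exp (-(rlo * (t - s)))) s := by
    intro s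
    have h := ((((hasDerivAt_id s).const_sub t).const_mul rlo).neg.exp).div_const rlo
    field_simp at h
    simpa using h
  rw [integral_eq_sub_of_hasDerivAt (fun s _ => hd s) ((continuous_weight rlo t).intervalIntegrable _ _)]
  simp only [sub_self, mul_zero, neg_zero, Real.exp_zero]
  rw [div_sub_div_same]
  refine div_le_div_of_nonneg_right ?_ hrlo.le
  linarith [Real.exp_pos (-(rlo * (t - 0)))]

/-- **THE FORCED AVERAGING ESTIMATE, WEIGHTED `L¹` FORCING (relative to an a priori bound).**  Let `Ḡ` be coercive with rate `r_lo > 0` and `‖Ḡ‖ ≤ Gn`;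
`g` continuous with `‖g(s)‖ ≤ L` on `[0, t]` and window means `‖∫_{nP}^{(n+1)P} g‖ ≤ η P` for every full window inside `[0, t]` (`P > 0`, `η ≥ 0`);
`ρ` continuous on `[0,t]`; `x` continuous on `[0,t]`, solving `x' = -(Ḡ x + g x) + ρ` on `(0,t)`, with `‖x(s)‖ ≤ M` on `[0,t]`.  Then
`‖x(t) - exp(-tḠ) x(0)‖ ≤ M (η (min(t, 1/r_lo) + P) + L P (1 + (2 Gn + L)/r_lo)) + (1 + L P) ∫₀ᵗ e^{-r_lo(t-s)} ‖ρ(s)‖ ds`.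
[cite: SandersVerhulstMurdock2007, Theorem 2.8.1 and Theorem 5.5.1 (Eckhaus/Sanchez-Palencia), inhomogeneous linear case]
[cite: Hale1980, Ch. V §3 Lemma 3.2] -/
theorem norm_sub_exp_apply_le_forced_weighted (G : E →L[ℝ] E) {g : ℝ → E →L[ℝ] E} (hg : Continuous g) {ρ : ℝ → E}
    (x : ℝ → E) {rlo Gn L η P M t : ℝ} (hrlo : 0 < rlo) (hP : 0 < P) (hη : 0 ≤ η) (ht : 0 ≤ t)
    (hcoer : ∀ v : E, rlo * ‖v‖ ^ 2 ≤ ⟪G v, v⟫_ℝ) (hGn : ‖G‖ ≤ Gn)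
    (hL : ∀ s ∈ Icc 0 t, ‖g s‖ ≤ L)
    (hmean : ∀ n : ℕ, ((n : ℝ) + 1) * P ≤ t →
      ‖∫ s in ((n : ℝ) * P)..(((n : ℝ) + 1) * P), g s‖ ≤ η * P)
    (hxc : ContinuousOn x (Icc 0 t)) (hρc : ContinuousOn ρ (Icc 0 t))
    (hx : ∀ s ∈ Ioo 0 t, HasDerivAt x (-(G (x s) + g s (x s)) + ρ s) s)
    (hM : ∀ s ∈ Icc 0 t, ‖x s‖ ≤ M) :
    ‖x t - exp (-(t • G)) (x 0)‖ ≤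
      M * (η * (min t (1 / rlo) + P) + L * P * (1 + (2 * Gn + L) / rlo)) +
        (1 + L * P) * ∫ s in (0:ℝ)..t, Real.exp (-(rlo * (t - s))) * ‖ρ s‖ := by
  have h0I : (0 : ℝ) ∈ Icc 0 t := ⟨le_rfl, ht⟩
  have hM0 : 0 ≤ M := (norm_nonneg _).trans (hM 0 h0I)
  have hL0 : 0 ≤ L := (norm_nonneg _).trans (hL 0 h0I)
  have hGn0 : 0 ≤ Gn := (norm_nonneg _).trans hGn
  set K : ℝ := L * P * (2 * Gn + L) * M with hK
  have hK0 : 0 ≤ K := by positivity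
  have hwc := continuous_weight rlo t
  -- the weighted forcing density and its integrability on sub-intervals of `[0,t]`
  set φ : ℝ → ℝ := fun s => Real.exp (-(rlo * (t - s))) * ‖ρ s‖ with hφ
  have hφc : ContinuousOn φ (Icc 0 t) := hwc.continuousOn.mul hρc.norm
  have hφi : ∀ a b, 0 ≤ a → a ≤ b → b ≤ t → IntervalIntegrable φ volume a b := fun a b ha hab hbt =>
    (hφc.mono (Icc_subset_Icc ha hbt)).intervalIntegrable_of_Icc hab
  have hφ0 : ∀ a b, 0 ≤ a → a ≤ b → b ≤ t → 0 ≤ ∫ s in a..b, φ s := fun a b ha hab hbt =>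
    intervalIntegral.integral_nonneg hab fun s _ => mul_nonneg (Real.exp_pos _).le (norm_nonneg _)
  -- the windows
  set N : ℕ := ⌊t / P⌋₊ with hN
  have hNP : (N : ℝ) * P ≤ t := by
    have := Nat.floor_le (div_nonneg ht hP.le); rw [← hN] at this
    exact (le_div_iff₀ hP).1 this
  have htNP : t - N * P ≤ P := by
    have := Nat.lt_floor_add_one (t / P); rw [← hN] at this
    have := (div_lt_iff₀ hP).1 this
    linarith
  set f : ℝ → E := fun s => exp (-((t - s) • G)) (g s (x s)) with hf
  have hfc : ContinuousOn f (Icc 0 t) :=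
    (continuous_exp_neg_sub_smul'' G t).continuousOn.clm_apply (hg.continuousOn.clm_apply hxc)
  have hfi : ∀ a b, 0 ≤ a → a ≤ b → b ≤ t → IntervalIntegrable f volume a b := fun a b ha hab hbt =>
    (hfc.mono (Icc_subset_Icc ha hbt)).intervalIntegrable_of_Icc hab
  -- the Duhamel forcing integral
  have hforce : ‖∫ s in (0 : ℝ)..t, exp (-((t - s) • G)) (ρ s)‖ ≤ ∫ s in (0:ℝ)..t, φ s := by
    refine norm_integral_le_of_norm_le ht (Filter.Eventually.of_forall fun s hs => ?_) (hφi 0 t le_rfl ht le_rfl)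
    exact norm_exp_neg_smul_apply_le G hcoer _ (sub_nonneg.2 hs.2)
  rw [sub_exp_apply_eq_forced G hg x ht hxc hρc hx]
  have hsplit : ∫ s in (0 : ℝ)..t, f s =
      (∑ k ∈ Finset.range N, ∫ s in ((k : ℝ) * P)..(((k : ℝ) + 1) * P), f s) + ∫ s in ((N : ℝ) * P)..t, f s := by
    have hadj := sum_integral_adjacent_intervals (μ := volume) (f := f) (a := fun k : ℕ => (k : ℝ) * P)
      (n := N) (fun k hk => hfi _ _ (by positivity) (by push_cast; nlinarith)
        (le_trans (by push_cast; nlinarith [show ((k : ℝ) + 1) ≤ N by exact_mod_cast hk]) hNP))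
    simp only [Nat.cast_zero, zero_mul] at hadj
    push_cast at hadj ⊢
    rw [hadj]
    exact (integral_add_adjacent_intervals (hfi _ _ le_rfl (by positivity) hNP) (hfi _ _ (by positivity) hNP le_rfl)).symm
  have hφsplit : (∑ k ∈ Finset.range N, ∫ s in ((k : ℝ) * P)..(((k : ℝ) + 1) * P), φ s) + ∫ s in ((N : ℝ) * P)..t, φ s =
      ∫ s in (0 : ℝ)..t, φ s := by
    have hadj := sum_integral_adjacent_intervals (μ := volume) (f := φ) (a := fun k : ℕ => (k : ℝ) * P)
      (n := N) (fun k hk => hφi _ _ (by positivity) (by push_cast; nlinarith)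
        (le_trans (by push_cast; nlinarith [show ((k : ℝ) + 1) ≤ N by exact_mod_cast hk]) hNP))
    simp only [Nat.cast_zero, zero_mul] at hadj
    push_cast at hadj ⊢
    rw [hadj]
    exact integral_add_adjacent_intervals (hφi _ _ le_rfl (by positivity) hNP) (hφi _ _ (by positivity) hNP le_rfl)
  have hmainI : ‖∫ s in (0 : ℝ)..t, f s‖ ≤ M * (η * (min t (1 / rlo) + P) + L * P * (1 + (2 * Gn + L) / rlo)) +
      L * P * ∫ s in (0:ℝ)..t, φ s := by
    rw [hsplit]
    have hwin : ∀ k ∈ Finset.range N, ‖∫ s in ((k : ℝ) * P)..(((k : ℝ) + 1) * P), f s‖ ≤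
        Real.exp (-(rlo * (t - ((k : ℝ) + 1) * P))) * (η * P) * M +
          K * (∫ s in ((k : ℝ) * P)..(((k : ℝ) + 1) * P), Real.exp (-(rlo * (t - s)))) +
          L * P * ∫ s in ((k : ℝ) * P)..(((k : ℝ) + 1) * P), φ s := by
      intro k hk
      rw [Finset.mem_range] at hk
      have hk1 : ((k : ℝ) + 1) * P ≤ t :=
        le_trans (by nlinarith [show ((k : ℝ) + 1) ≤ N by exact_mod_cast hk]) hNP
      exact norm_integral_window_le_forced_weighted G hg x (by positivity) (by nlinarith) hk1 (by ring_nf; rfl)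
        hcoer hGn hL (hmean k hk1) hxc hρc hx hM
    have hlast : ‖∫ s in ((N : ℝ) * P)..t, f s‖ ≤
        Real.exp (-(rlo * (t - t))) * (L * P) * M + K * (∫ s in ((N : ℝ) * P)..t, Real.exp (-(rlo * (t - s)))) +
          L * P * ∫ s in ((N : ℝ) * P)..t, φ s := by
      refine norm_integral_window_le_forced_weighted G hg x (by positivity) hNP le_rfl htNP hcoer hGn hL ?_ hxc hρc hx hM
      have h1 : ‖∫ σ in ((N : ℝ) * P)..t, g σ‖ ≤ L * |t - N * P| :=
        norm_integral_le_of_norm_le_const fun σ hσ => hL σ (by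
          rw [uIoc_of_le hNP] at hσ; exact ⟨le_trans (by positivity) hσ.1.le, hσ.2⟩)
      rw [abs_of_nonneg (sub_nonneg.2 hNP)] at h1
      exact h1.trans (mul_le_mul_of_nonneg_left htNP hL0)
    have hei : ∀ a b : ℝ, IntervalIntegrable (fun s => Real.exp (-(rlo * (t - s)))) volume a b :=
      fun a b => hwc.intervalIntegrable _ _
    have hesum : (∑ k ∈ Finset.range N, ∫ s in ((k : ℝ) * P)..(((k : ℝ) + 1) * P),
        Real.exp (-(rlo * (t - s)))) + ∫ s in ((N : ℝ) * P)..t, Real.exp (-(rlo * (t - s))) =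
        ∫ s in (0 : ℝ)..t, Real.exp (-(rlo * (t - s))) := by
      have hadj := sum_integral_adjacent_intervals (μ := volume)
        (f := fun s => Real.exp (-(rlo * (t - s)))) (a := fun k : ℕ => (k : ℝ) * P) (n := N)
        (fun k _ => hei _ _)
      simp only [Nat.cast_zero, zero_mul] at hadj
      push_cast at hadj ⊢
      rw [hadj]
      exact integral_add_adjacent_intervals (hei _ _) (hei _ _)
    have heint : ∫ s in (0 : ℝ)..t, Real.exp (-(rlo * (t - s))) ≤ 1 / rlo := integral_exp_neg_sub_le_inv hrlo
    have hS1 := sum_exp_neg_le'' hrlo hP N hNP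
    have hSmin : (∑ k ∈ Finset.range N, Real.exp (-(rlo * (t - ((k : ℝ) + 1) * P)))) * (η * P) * M ≤
        M * (η * (min t (1 / rlo) + P)) := by
      have h1 : P * (∑ k ∈ Finset.range N, Real.exp (-(rlo * (t - ((k : ℝ) + 1) * P)))) ≤ P + 1 / rlo := by
        calc P * (∑ k ∈ Finset.range N, Real.exp (-(rlo * (t - ((k : ℝ) + 1) * P))))
            ≤ P * (1 + 1 / (rlo * P)) := mul_le_mul_of_nonneg_left hS1 hP.le
          _ = P + 1 / rlo := by field_simp
      have hterm : ∀ k ∈ Finset.range N, Real.exp (-(rlo * (t - ((k : ℝ) + 1) * P))) ≤ 1 := by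
        intro k hk
        rw [Finset.mem_range] at hk
        rw [Real.exp_le_one_iff]
        have hk1 : ((k : ℝ) + 1) * P ≤ t := by
          have : ((k : ℝ) + 1) ≤ N := by exact_mod_cast hk
          nlinarith
        nlinarith
      have hS2 : ∑ k ∈ Finset.range N, Real.exp (-(rlo * (t - ((k : ℝ) + 1) * P))) ≤ N := by
        calc ∑ k ∈ Finset.range N, Real.exp (-(rlo * (t - ((k : ℝ) + 1) * P)))
            ≤ ∑ _k ∈ Finset.range N, (1 : ℝ) := Finset.sum_le_sum hterm
          _ = N := by simp
      have h2 : P * (∑ k ∈ Finset.range N, Real.exp (-(rlo * (t - ((k : ℝ) + 1) * P)))) ≤ t := by nlinarith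
      have h3 : P * (∑ k ∈ Finset.range N, Real.exp (-(rlo * (t - ((k : ℝ) + 1) * P)))) ≤ min t (1 / rlo) + P := by
        rcases le_total t (1 / rlo) with h | h
        · rw [min_eq_left h]; linarith
        · rw [min_eq_right h]; linarith
      calc (∑ k ∈ Finset.range N, Real.exp (-(rlo * (t - ((k : ℝ) + 1) * P)))) * (η * P) * M
          = (η * M) * (P * ∑ k ∈ Finset.range N, Real.exp (-(rlo * (t - ((k : ℝ) + 1) * P)))) := by ring
        _ ≤ (η * M) * (min t (1 / rlo) + P) := mul_le_mul_of_nonneg_left h3 (mul_nonneg hη hM0)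
        _ = M * (η * (min t (1 / rlo) + P)) := by ring
    have hA : (∑ k ∈ Finset.range N, (Real.exp (-(rlo * (t - ((k : ℝ) + 1) * P))) * (η * P) * M +
        K * (∫ s in ((k : ℝ) * P)..(((k : ℝ) + 1) * P), Real.exp (-(rlo * (t - s)))) +
        L * P * ∫ s in ((k : ℝ) * P)..(((k : ℝ) + 1) * P), φ s)) =
        (∑ k ∈ Finset.range N, Real.exp (-(rlo * (t - ((k : ℝ) + 1) * P)))) * (η * P) * M +
          K * (∑ k ∈ Finset.range N, ∫ s in ((k : ℝ) * P)..(((k : ℝ) + 1) * P), Real.exp (-(rlo * (t - s)))) +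
          L * P * ∑ k ∈ Finset.range N, ∫ s in ((k : ℝ) * P)..(((k : ℝ) + 1) * P), φ s := by
      rw [Finset.sum_add_distrib, Finset.sum_add_distrib, Finset.sum_mul, Finset.sum_mul, Finset.mul_sum, Finset.mul_sum]
    calc ‖(∑ k ∈ Finset.range N, ∫ s in ((k : ℝ) * P)..(((k : ℝ) + 1) * P), f s) + ∫ s in ((N : ℝ) * P)..t, f s‖
        ≤ (∑ k ∈ Finset.range N, ‖∫ s in ((k : ℝ) * P)..(((k : ℝ) + 1) * P), f s‖) + ‖∫ s in ((N : ℝ) * P)..t, f s‖ :=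
          (norm_add_le _ _).trans (add_le_add (norm_sum_le _ _) le_rfl)
      _ ≤ (∑ k ∈ Finset.range N, (Real.exp (-(rlo * (t - ((k : ℝ) + 1) * P))) * (η * P) * M +
            K * (∫ s in ((k : ℝ) * P)..(((k : ℝ) + 1) * P), Real.exp (-(rlo * (t - s)))) +
            L * P * ∫ s in ((k : ℝ) * P)..(((k : ℝ) + 1) * P), φ s)) +
            (Real.exp (-(rlo * (t - t))) * (L * P) * M + K * (∫ s in ((N : ℝ) * P)..t, Real.exp (-(rlo * (t - s)))) +
              L * P * ∫ s in ((N : ℝ) * P)..t, φ s) :=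
          add_le_add (Finset.sum_le_sum hwin) hlast
      _ = (∑ k ∈ Finset.range N, Real.exp (-(rlo * (t - ((k : ℝ) + 1) * P)))) * (η * P) * M + L * P * M +
            K * ((∑ k ∈ Finset.range N, ∫ s in ((k : ℝ) * P)..(((k : ℝ) + 1) * P), Real.exp (-(rlo * (t - s)))) +
              ∫ s in ((N : ℝ) * P)..t, Real.exp (-(rlo * (t - s)))) +
            L * P * ((∑ k ∈ Finset.range N, ∫ s in ((k : ℝ) * P)..(((k : ℝ) + 1) * P), φ s) + ∫ s in ((N : ℝ) * P)..t, φ s) := by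
          rw [hA]
          simp only [sub_self, mul_zero, neg_zero, Real.exp_zero, one_mul]
          ring
      _ ≤ M * (η * (min t (1 / rlo) + P)) + L * P * M + K * (1 / rlo) + L * P * ∫ s in (0:ℝ)..t, φ s := by
          rw [hesum, hφsplit]
          have := mul_le_mul_of_nonneg_left heint hK0
          linarith [hSmin]
      _ = M * (η * (min t (1 / rlo) + P) + L * P * (1 + (2 * Gn + L) / rlo)) + L * P * ∫ s in (0:ℝ)..t, φ s := by
          rw [hK]; field_simp; ring
  calc ‖-(∫ s in (0 : ℝ)..t, f s) + ∫ s in (0 : ℝ)..t, exp (-((t - s) • G)) (ρ s)‖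
      ≤ ‖∫ s in (0 : ℝ)..t, f s‖ + ‖∫ s in (0 : ℝ)..t, exp (-((t - s) • G)) (ρ s)‖ :=
        (norm_add_le _ _).trans (by rw [norm_neg])
    _ ≤ (M * (η * (min t (1 / rlo) + P) + L * P * (1 + (2 * Gn + L) / rlo)) + L * P * ∫ s in (0:ℝ)..t, φ s) +
          ∫ s in (0:ℝ)..t, φ s := add_le_add hmainI hforce
    _ = M * (η * (min t (1 / rlo) + P) + L * P * (1 + (2 * Gn + L) / rlo)) + (1 + L * P) * ∫ s in (0:ℝ)..t, φ s := by ring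

end Literature.Analysis.ODE.PeriodicAveraging

end
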